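import Mathlib
import HarnessLib
import Summits.Langlands.Langlands.Theses.ParityBlindBianchi
import Summits.Langlands.Langlands.Theses.RuelleTorsionArtinWeight
import Summits.Langlands.Langlands.Theorems.ParityBlindBianchiArtinWeightRealisationLevel
import Literature.NumberTheory.Automorphic.PiOfArtinRepAtSigmaUnramifiedPlaces
import Literature.NumberTheory.Automorphic.CuspidalRepGL2Exists

/-!
# The converse bookkeeping R′ ⇒ R: `ParityBlindBianchi.ArtinWeightRealisationLevel`
(crux stmt-Langlands-15111) implies the shared a.e. crux
`RuelleTorsionArtinWeight.ArtinWeightRealisation` (stmt-Langlands-11057) UNCONDITIONALLY —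
line `Sketch`, continuation lead c1 (`--supports`)

The landed composition `artinWeightRealisationLevel_of_artinWeightRealisation`
(`ParityBlindBianchiArtinWeightRealisationLevel.lean`) gives `R → hG → hC → R′`.  This file proves
the converse `R′ → R` with no classical input at all, so that the two cruxes are recorded as
EQUIVALENT modulo the two named facts `hG` (Gelbart 1997 Prop. 4.1, σ-unramified shadow) and `hC`
(cusp forms exist on `GL₂`): `artinWeightRealisationLevel_iff_artinWeightRealisation`.

The argument is pure bookkeeping.  Given the hypothesis package of R (a finite set `S` of places of
`K` containing the places over `p`, an open level `U` saturated at `S`, uniformisers, an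
`𝒪_{ℚ̄_p}`-valued Hecke point of the `p`-power tower indexed by `{v // v ∉ S} × Fin 2`, Hansen
association off `S`), put `S₀ := {p} ∪ {N(v) : v ∈ S}` (absolute norms; `Ideal.absNorm_mem`:
`N(v) ∈ v`).  Every place of `K` that is good for `S₀` (over no element of `S₀`) lies outside `S`, so
the package restricts to the good places: the level condition weakens, association is inherited,
and the Hecke point PULLS BACK along the map of index types `{v // v good} × Fin 2 → {v // v ∉ S} × Fin 2`
(`isHeckePoint_comp`: the big Hecke algebra of a sub-family is a subalgebra of the big Hecke algebra
of the family, and a continuous point restricts to it).  R′ then returns a cuspidal `π` compatible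
with `σ` at every `S₀`-good place; since `0 ∉ S₀` (`p ≠ 0`, `N(v) ≠ 0` by
`Ideal.absNorm_eq_zero_iff`) the `S₀`-bad places are finitely many (`Ideal.finite_factors`), which
is the a.e. conclusion of R.

* `towerHeckeAlgebra_comp_le`, `bigHeckeAlgebra_comp_le`, `isHeckePoint_comp` — restriction of a
  Hecke point to a sub-family (any map of index types; compare the landed
  `isHeckePoint_comp_equiv` for equivalences);
* `finite_setOf_not_good` — for `0 ∉ S₀` the `S₀`-bad places of `K` form a finite set;
* `artinWeightRealisation_of_artinWeightRealisationLevel : R′ → R`;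
* `artinWeightRealisationLevel_iff_artinWeightRealisation : hG → hC → (R′ ↔ R)` (against the
  named Literature facts).

No definitions; nothing here is specific to `GL₂` except the two route statements.
-/

noncomputable section

open scoped BigOperators Topology Classical Matrix NumberField MatrixGroups
open Literature.NumberTheory.Automorphic Literature.NumberTheory.GaloisRepresentations
  IsDedekindDomain NumberField Filter

universe u v w

-- `Summit.Langlands.Langlands.…`: summit = sub-problem name (D-0017 nested layout), not a typo.
set_option linter.dupNamespace false

namespace Summit.Langlands.Langlands.Theorems.ArtinWeightRealisationLevel

section Pullback

variable {k : Type u} [CommRing k] {Γ 𝒢 : Type u} [Group Γ] [Group 𝒢]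
  (ι : Γ →* 𝒢) (T : LevelTower 𝒢) (ϖ : k) {J : Type v} {J' : Type w}

/-- The tower Hecke algebra generated by a sub-family `δ ∘ e` of Hecke operators is contained in
the one generated by the family `δ` (`Algebra.adjoin` is monotone in the generating set, and
`range (δ ∘ e) ⊆ range δ`). [folklore] -/
theorem towerHeckeAlgebra_comp_le (e : J' → J) (δ : J → 𝒢) :
    towerHeckeAlgebra k ι T ϖ (δ ∘ e) ≤ towerHeckeAlgebra k ι T ϖ δ := by
  unfold towerHeckeAlgebra
  refine Algebra.adjoin_mono ?_
  rintro x ⟨j, rfl⟩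
  exact ⟨e j, rfl⟩

/-- The big Hecke algebra of a sub-family `δ ∘ e` is contained in the big Hecke algebra of the
family `δ` (closure of a smaller dense subalgebra). [folklore] -/
theorem bigHeckeAlgebra_comp_le (e : J' → J) (δ : J → 𝒢) :
    bigHeckeAlgebra k ι T ϖ (δ ∘ e) ≤ bigHeckeAlgebra k ι T ϖ δ := by
  intro x hx I
  obtain ⟨a, ha, hxa⟩ := hx I
  exact ⟨a, towerHeckeAlgebra_comp_le ι T ϖ e δ ha, hxa⟩

/-- **A Hecke point restricts to any sub-family.**  If `χ : J → k` is a (`k`-valued, continuous)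
point of the big Hecke algebra of the family `δ : J → 𝒢` (`IsHeckePoint`), then for every map of
index types `e : J' → J` the restricted system `χ ∘ e` is a point of the big Hecke algebra of the
sub-family `δ ∘ e`: compose the stage-`t` homomorphisms with the inclusion of big Hecke algebras
(`bigHeckeAlgebra_comp_le`); continuity (factoring through finitely many pieces) and the values on
the generators are inherited. [folklore] -/
theorem isHeckePoint_comp (e : J' → J) (δ : J → 𝒢) (χ : J → k)
    (h : IsHeckePoint ι T ϖ δ χ) : IsHeckePoint ι T ϖ (δ ∘ e) (χ ∘ e) := by
  intro t
  obtain ⟨I, φ, hcont, hgen⟩ := h t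
  refine ⟨I, φ.comp (Subalgebra.inclusion (bigHeckeAlgebra_comp_le ι T ϖ e δ)), ?_, ?_⟩
  · intro x y hxy
    simp only [AlgHom.comp_apply]
    apply hcont
    intro z hz
    exact hxy z hz
  · intro j
    have h1 : Subalgebra.inclusion (bigHeckeAlgebra_comp_le ι T ϖ e δ)
        ⟨towerHeckeFamily k ι T ϖ ((δ ∘ e) j), towerHeckeFamily_mem_bigHeckeAlgebra k ι T ϖ (δ ∘ e) j⟩ =
        ⟨towerHeckeFamily k ι T ϖ (δ (e j)), towerHeckeFamily_mem_bigHeckeAlgebra k ι T ϖ δ (e j)⟩ :=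
      Subtype.ext rfl
    rw [AlgHom.comp_apply, h1]
    exact hgen (e j)

end Pullback

/-- For a finite set `S₀` of natural numbers not containing `0`, the places `v` of a number field
`K` lying over some `ℓ ∈ S₀` (i.e. `(ℓ : 𝓞 K) ∈ v`) form a finite set: each nonzero `(ℓ) ⊆ 𝓞 K`
has finitely many prime factors (`Ideal.finite_factors`). [folklore] -/
theorem finite_setOf_not_good (K : Type) [Field K] [NumberField K] (S₀ : Finset ℕ)
    (h0 : (0 : ℕ) ∉ S₀) :
    {v : HeightOneSpectrum (𝓞 K) | ¬ ∀ ℓ ∈ S₀, ((ℓ : ℕ) : 𝓞 K) ∉ v.asIdeal}.Finite := by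
  have hsub : {v : HeightOneSpectrum (𝓞 K) | ¬ ∀ ℓ ∈ S₀, ((ℓ : ℕ) : 𝓞 K) ∉ v.asIdeal} ⊆
      ⋃ ℓ ∈ (S₀ : Set ℕ),
        {v : HeightOneSpectrum (𝓞 K) | v.asIdeal ∣ Ideal.span {((ℓ : ℕ) : 𝓞 K)}} := by
    intro v hv
    simp only [Set.mem_setOf_eq, not_forall, not_not, exists_prop] at hv
    obtain ⟨ℓ, hℓ, hmem⟩ := hv
    simp only [Set.mem_iUnion, Set.mem_setOf_eq, exists_prop]
    exact ⟨ℓ, hℓ, Ideal.dvd_span_singleton.mpr hmem⟩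
  refine Set.Finite.subset (Set.Finite.biUnion S₀.finite_toSet fun ℓ hℓ => ?_) hsub
  apply Ideal.finite_factors
  have hℓ0 : ℓ ≠ 0 := fun h => h0 (h ▸ hℓ)
  intro hbot
  rw [Submodule.zero_eq_bot, Ideal.span_singleton_eq_bot] at hbot
  exact (Nat.cast_ne_zero.mpr hℓ0) hbot

/-- **R′ ⇒ R, unconditionally.**  `ParityBlindBianchi.ArtinWeightRealisationLevel`
(stmt-Langlands-15111: tame level pinned by a finite set of rational primes `S₀ ∋ p`, conclusion at
EVERY good place) implies `RuelleTorsionArtinWeight.ArtinWeightRealisation` (stmt-Langlands-11057: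
some finite set `S` of bad places containing those over `p`, conclusion almost everywhere).
Given R's package `(S, U, ϖ, a)` take `S₀ := insert p (S.image fun v ↦ Ideal.absNorm v.asIdeal)`:
an `S₀`-good place is outside `S` (`Ideal.absNorm_mem`), so `U` is saturated at the `S₀`-bad places,
association is inherited, and the Hecke point restricts along
`{v // v good} × Fin 2 → {v // v ∉ S} × Fin 2` (`isHeckePoint_comp`); R′ gives a cuspidal `π`
compatible at every `S₀`-good place, and the `S₀`-bad places are finitely many since `0 ∉ S₀`
(`finite_setOf_not_good`, `Ideal.absNorm_eq_zero_iff`). [folklore] -/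
theorem artinWeightRealisation_of_artinWeightRealisationLevel :
    Summit.Langlands.Langlands.Theses.ParityBlindBianchi.ArtinWeightRealisationLevel →
      Summit.Langlands.Langlands.Theses.RuelleTorsionArtinWeight.ArtinWeightRealisation := by
  intro hR' K _ _ htc hdeg p _ ι σ hfin hirr hyp
  obtain ⟨S, U, ϖ, a, hSp, hopen, hle, hlev, hϖ, hpt, hassoc⟩ := hyp
  -- every `S₀`-good place lies outside `S`, for `S₀ := insert p (S.image absNorm)`
  have hgood : ∀ v : HeightOneSpectrum (𝓞 K),
      (∀ ℓ ∈ insert p (S.image fun v : HeightOneSpectrum (𝓞 K) => Ideal.absNorm v.asIdeal),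
        ((ℓ : ℕ) : 𝓞 K) ∉ v.asIdeal) → v ∉ S := by
    intro v hv hvS
    exact hv _ (Finset.mem_insert_of_mem (Finset.mem_image_of_mem _ hvS))
      (Ideal.absNorm_mem v.asIdeal)
  have h0 : (0 : ℕ) ∉ insert p (S.image fun v : HeightOneSpectrum (𝓞 K) => Ideal.absNorm v.asIdeal) := by
    intro h
    rcases Finset.mem_insert.mp h with h | h
    · exact (Fact.out : p.Prime).ne_zero h.symm
    · obtain ⟨v, -, hv⟩ := Finset.mem_image.mp h
      exact v.ne_bot (Ideal.absNorm_eq_zero_iff.mp hv)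
  have hp : p ∈ insert p (S.image fun v : HeightOneSpectrum (𝓞 K) => Ideal.absNorm v.asIdeal) :=
    Finset.mem_insert_self _ _
  -- the restriction map of index types
  let e : {v : HeightOneSpectrum (𝓞 K) //
      ∀ ℓ ∈ insert p (S.image fun v : HeightOneSpectrum (𝓞 K) => Ideal.absNorm v.asIdeal),
        ((ℓ : ℕ) : 𝓞 K) ∉ v.asIdeal} × Fin 2 → {v : HeightOneSpectrum (𝓞 K) // v ∉ S} × Fin 2 :=
    fun j => (⟨j.1.1, hgood j.1.1 j.1.2⟩, j.2)
  have key := isHeckePoint_comp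
      (Matrix.GeneralLinearGroup.map (n := Fin 2) (algebraMap K (FiniteAdeleRing (𝓞 K) K)))
      (LevelTower.ofSeq U (fun r : ℕ =>
        (principalCongruenceLevel 2 K (Ideal.span {((p : ℕ) : 𝓞 K)} ^ r)).map (GLn.sndHom 2 K)))
      ((p : ℕ) : (Valued.v (R := PadicAlgCl p)).valuationSubring) e
      (fun j : {v : HeightOneSpectrum (𝓞 K) // v ∉ S} × Fin 2 =>
        GLn.sndHom 2 K (heckeDiagAt 2 K j.1.1 (ϖ j.1.1) (j.2.val + 1)))
      (fun j => a j.1 (j.2.val + 1)) hpt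
  obtain ⟨hcpt, π, hall⟩ := hR' K htc hdeg p ι σ hfin hirr
    (insert p (S.image fun v : HeightOneSpectrum (𝓞 K) => Ideal.absNorm v.asIdeal)) hp
    ⟨U, ϖ, fun v n => a ⟨v.1, hgood v.1 v.2⟩ n, hopen, hle, fun g hg hgS =>
      hlev g hg fun v hvS => hgS v fun hv => hgood v hv hvS, hϖ, key,
      fun v hv => hassoc v (hgood v hv)⟩
  refine ⟨hcpt, π, ?_⟩
  rw [Filter.eventually_cofinite]
  exact (finite_setOf_not_good K _ h0).subset fun w hw hgw => hw (hall w hgw)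

/-- **The two cruxes are equivalent modulo two classical named facts.**  Under Gelbart 1997
Prop. 4.1 (σ-unramified shadow, `frobSatakeCompatibleAt_of_isPiOfArtinRep_of_isUnramifiedAt`) and
the existence of cuspidal automorphic representations of `GL₂` over every number field
(`nonempty_cuspidalAutomorphicRepData_two`, consumed only by the degenerate sector `0 ∈ S₀` of R′),
`ParityBlindBianchi.ArtinWeightRealisationLevel` (stmt-Langlands-15111) and
`RuelleTorsionArtinWeight.ArtinWeightRealisation` (stmt-Langlands-11057) are EQUIVALENT: `→` is
`artinWeightRealisation_of_artinWeightRealisationLevel` (unconditional), `←` is the landed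
`artinWeightRealisationLevel_of_artinWeightRealisation`. [folklore] -/
theorem artinWeightRealisationLevel_iff_artinWeightRealisation
    (hG : Literature.NumberTheory.Automorphic.frobSatakeCompatibleAt_of_isPiOfArtinRep_of_isUnramifiedAt)
    (hC : Literature.NumberTheory.Automorphic.nonempty_cuspidalAutomorphicRepData_two) :
    Summit.Langlands.Langlands.Theses.ParityBlindBianchi.ArtinWeightRealisationLevel ↔
      Summit.Langlands.Langlands.Theses.RuelleTorsionArtinWeight.ArtinWeightRealisation :=
  ⟨artinWeightRealisation_of_artinWeightRealisationLevel, fun hR =>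
    artinWeightRealisationLevel_of_artinWeightRealisation hR
      (fun hcpt σ π hπ v hv => hG hcpt σ π hπ v hv) (fun F _ _ hF => hC F hF)⟩

end Summit.Langlands.Langlands.Theorems.ArtinWeightRealisationLevel

end
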